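import Mathlib.Data.Real.Basic
import Mathlib.Tactic.Positivity
import Mathlib.Tactic.Ring
import Mathlib.Tactic.Linarith
import HarnessLib

/-!
# The Θ-identity for the refined row R1 and the two-arm block certificates

Support file for `stmt-CriticalPhenomena-4575` (memo `prim-gen-kcluster/KCLUSTER-gen65.md`, unit
prim-gen-kcluster, gen 65).  Pure real algebra — no definitions (the named quantities enter as hypotheses
`e… : X = …`), no sorries.

**Setting (memo §1–2).**  `G` is a finite graph with edge parameters in `[0,1)` and random-cluster weights
`w(ω) = p^ω (1-p)^(1-ω) q^{k(ω)}`, `q > 0`; `a, b, c` are the terminals of the refined row R1,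
`t·s_a ≤ u_b·u_c` (KCLUSTER-gen32; at `q = 1` it is the tree's `RefinedRowR1.r1_PrW` = dual BHK). 
Suppose two
vertices `h₁, h₂` ("hubs") leave `a, b, c` in three different components of `G − {h₁,h₂}`; their
closures are
the ARMS `A_a, A_b, A_c` (further components are effective hub edges and are absorbed into `A_b`).  For
an arm
with hubs `0, 1` and marked terminal `t` write, for the weights of the arm ALONE, `A = w(0~1~t)`,
`B = w(0~1, t apart)`, `C = w(t~0 only)`, `D = w(t~1 only)`, `E = w(t, 0, 1 pairwise apart)`,
`N = w(apart ∧ the open cluster of 0 separates t from 1 in the support)`, `N' = w(apart ∧ the cluster of 1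
separates t from 0)` (below `bN, bM` and `cN, cM`).  Gluing the arms: `k(G) = Σ k(arm) − 4 + c − [c ≥ 1]`
(`c` = number of arms linking the hubs); the clusters of the terminals are read off the arm states; `s_a`
holds iff `C_a` contains a hub and, when it contains exactly one hub `h`, not both `b` and `c` reach the
other hub avoiding `C_h` (dictionary verified against brute force in exact arithmetic, memo §2).  In these
coordinates `u_b·u_c − t·s_a` on `G` (a common positive factor dropped) is the left side of
`theta_identity`,
where `aA = w_a(a~h₁~h₂)`, `aC = w_a(a~h₁ only)`, `aD = w_a(a~h₂ only)` are apex-arm weights.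

**Results.** (1) `theta_identity` (by `ring`): the slack is the quadratic form
`aC²·R1⁰ + aD²·R1¹ + aC·aD·CROSS + aA·aC·W⁰ + aA·aD·W¹`, whose coefficients are two-arm quantities of
`A_b ∥ A_c`: R1 at a hub (Harris form `B·C − T·H`), the two-hub CROSS term, and the wired/free cross
terms.
(2) `R10_cert … W1_cert` (by `ring` + `positivity`): `bA·cA·(block)` is a polynomial with non-negative
integer coefficients in the arm weights, `q`, and the slacks `φ = A·E − B·(C+D)` (FKG on the arm:
`P(t joins | hubs linked) ≥ P(t meets a hub | not linked)`, valid for `q ≥ 1`), `ρ = B·C − A·N` and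
`σ = B·D − A·N'` (the refined row R1 ON THE ARM with a hub as apex, Harris form `T·H ≤ B·C`).
(3) `theta_slack_nonneg`: hence the Θ-slack is `≥ 0` whenever both terminal arms satisfy FKG and R1 at
their hubs.  Consequences (memo §0): a minimal counterexample to R1 for `φ_{p,q}`, `q ≥ 1`, has no hub
pair
separating the three terminals; with gen 56 (outerplanar cofacial case) and gen 57 (series/parallel/1-sum
reductions) R1 — `t·s_a ≤ u_b·u_c` — holds for EVERY random-cluster measure with `q ≥ 1` on EVERY
series-parallel graph.  [this work]
-/

namespace Summit.CriticalPhenomena.PercolationContinuityZ3.Theorems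

namespace ThetaBlocks

/-- **Θ-identity**: the R1-slack `u_b·u_c − t·s_a` of `Θ(A_a, A_b, A_c)` written in arm weights
(`T, S, Ub, Uc` the four cells; `aA, aC, aD` the apex-arm weights) is a quadratic form in `(aA, aC, aD)`
whose coefficients are the five two-arm blocks, with no `aA²` term. [this work] -/
theorem theta_identity (aA aC aD : ℝ) (bA bB bC bD bE bN bM cA cB cC cD cE cN cM q : ℝ)
    (Lb Mb Lc Mc Z : ℝ) (eLb : Lb = bA + bB) (eMb : Mb = bC + bD + bE) (eLc : Lc = cA + cB)
    (eMc : Mc = cC + cD + cE) (eZ : Z = q * Lb * Lc + Lb * Mc + Mb * Lc + Mb * Mc)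
    (T0 B0 C0 H0 : ℝ) (eT0 : T0 = q * bA * cA + bA * (cC + cD) + (bC + bD) * cA + bC * cC)
    (eB0 : B0 = q * bA * Lc + bA * Mc + (bC + bD) * Lc + bC * Mc)
    (eC0 : C0 = q * cA * Lb + cA * Mb + (cC + cD) * Lb + cC * Mb)
    (eH0 : H0 = Z - (Mb - bC - bN) * (Mc - cC - cN))
    (T1 B1 C1 H1 : ℝ) (eT1 : T1 = q * bA * cA + bA * (cC + cD) + (bC + bD) * cA + bD * cD)
    (eB1 : B1 = q * bA * Lc + bA * Mc + (bC + bD) * Lc + bD * Mc)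
    (eC1 : C1 = q * cA * Lb + cA * Mb + (cC + cD) * Lb + cD * Mb)
    (eH1 : H1 = Z - (Mb - bD - bM) * (Mc - cD - cM))
    (xb xb' yc yc' : ℝ) (exb : xb = q * bA + bC + bD) (exb' : xb' = q * bB + bE)
    (eyc : yc = q * cA + cC + cD) (eyc' : yc' = q * cB + cE)
    (T S Ub Uc : ℝ) (eT : T = aA * xb * yc + aC * T0 + aD * T1)
    (eUc : Uc = aA * xb * yc' + aC * (B0 - T0) + aD * (B1 - T1))
    (eUb : Ub = aA * xb' * yc + aC * (C0 - T0) + aD * (C1 - T1))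
    (eS : S = aA * xb' * yc' + aC * (H0 - B0 - C0 + T0) + aD * (H1 - B1 - C1 + T1)) :
    Ub * Uc - T * S
      = aC ^ 2 * (B0 * C0 - T0 * H0) + aD ^ 2 * (B1 * C1 - T1 * H1)
        + aC * aD * (B0 * C1 + B1 * C0 - T0 * H1 - T1 * H0)
        + aA * aC * (yc * (xb + xb') * B0 + xb * (yc + yc') * C0 - (xb + xb') * (yc + yc') * T0 - xb *
        yc * H0)
        + aA * aD * (yc * (xb + xb') * B1 + xb * (yc + yc') * C1 - (xb + xb') * (yc + yc') * T1 - xb *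
        yc * H1) := by
  subst eT eUc eUb eS eH0 eH1 eB0 eC0 eB1 eC1 eT0 eT1 eZ eLb eMb eLc eMc exb exb' eyc eyc'
  ring

set_option maxHeartbeats 4000000 in
set_option maxRecDepth 20000 in
/-- Certificate for R1 at hub `h₁` of `A_b ∥ A_c`, Harris form `B⁰C⁰ − T⁰H⁰`: `bA·cA·(block)` equals a
polynomial with non-negative
integer coefficients in the arm weights, `q` and the slacks, hence it is `≥ 0`. [this work] -/
theorem R10_cert (bA bB bC bD bE bN cA cB cC cD cE cN q : ℝ)
    (hbA : 0 ≤ bA) (hbB : 0 ≤ bB) (hbC : 0 ≤ bC) (hbD : 0 ≤ bD) (hcA : 0 ≤ cA) (hcB : 0 ≤ cB)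
    (hcC : 0 ≤ cC) (hcD : 0 ≤ cD) (hq : 0 ≤ q)
    (φb ρb φc ρc : ℝ) (eφb : bA * bE - bB * (bC + bD) = φb) (eρb : bB * bC - bA * bN = ρb)
    (eφc : cA * cE - cB * (cC + cD) = φc) (eρc : cB * cC - cA * cN = ρc)
    (hφb : 0 ≤ φb) (hρb : 0 ≤ ρb) (hφc : 0 ≤ φc) (hρc : 0 ≤ ρc)
    (Lb Mb Lc Mc Z : ℝ) (eLb : Lb = bA + bB) (eMb : Mb = bC + bD + bE) (eLc : Lc = cA + cB)
    (eMc : Mc = cC + cD + cE) (eZ : Z = q * Lb * Lc + Lb * Mc + Mb * Lc + Mb * Mc)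
    (T0 B0 C0 H0 : ℝ) (eT0 : T0 = q * bA * cA + bA * (cC + cD) + (bC + bD) * cA + bC * cC)
    (eB0 : B0 = q * bA * Lc + bA * Mc + (bC + bD) * Lc + bC * Mc)
    (eC0 : C0 = q * cA * Lb + cA * Mb + (cC + cD) * Lb + cC * Mb)
    (eH0 : H0 = Z - (Mb - bC - bN) * (Mc - cC - cN)) :
    0 ≤ bA * cA * (B0 * C0 - T0 * H0) := by
  have key : bA * cA * (B0 * C0 - T0 * H0) =
        bA^2*bD*cA*q*ρc + bA^2*bD*cC*ρc + bA^2*bD*cC*φc + bA^2*bD*cD*ρc + bA*bB*bD*cA*q*ρc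
        + bA*bB*bD*cC*ρc + bA*bB*bD*cC*φc + bA*bB*bD*cD*ρc + bA*bC*bD*cA*cC*cD + bA*bC*bD*cA*ρc
        + bA*bC*bD*cB*cC*cD + bA*bC*bD*cC*ρc + bA*bC*bD*cC*φc + bA*bD^2*cA*ρc + bA*cA^2*cD*q*ρb
        + bA*cA*cB*cD*q*ρb + bA*cA*cC*cD*ρb + bA*cA*cD^2*ρb + bA*cA*q*ρb*ρc + bA*cA*q*ρb*φc
        + bA*cA*q*ρc*φb + bA*cA*φb*φc + bA*cB*cC*cD*ρb + bA*cB*cD^2*ρb + bA*cC*ρb*ρc + bA*cC*ρb*φc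
        + bA*cC*ρc*φb + bA*cC*φb*φc + bA*cD*ρb*ρc + bA*cD*ρb*φc + bA*cD*ρc*φb + bB*bC*bD*cA*cC*cD
        + bB*bC*bD*cA*ρc + bB*bC*bD*cB*cC*cD + bB*bC*bD*cC*ρc + bB*bC*bD*cC*φc + bB*bD^2*cA*ρc
        + bC*cA^2*cD*ρb + bC*cA^2*cD*φb + bC*cA*cB*cD*ρb + bC*cA*cB*cD*φb + bC*cA*cC*cD*ρb
        + bC*cA*cC*cD*φb + bC*cA*ρb*ρc + bC*cA*ρb*φc + bC*cA*ρc*φb + bC*cA*φb*φc + bC*cB*cC*cD*ρb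
        + bC*cB*cC*cD*φb + bC*cC*ρb*ρc + bC*cC*ρb*φc + bC*cC*ρc*φb + bC*cC*φb*φc + bD*cA^2*cD*ρb
        + bD*cA*cB*cD*ρb + bD*cA*ρb*ρc + bD*cA*ρb*φc + bD*cA*ρc*φb := by
    subst eφb eρb eφc eρc eH0 eB0 eC0 eT0 eZ eLb eMb eLc eMc
    ring
  rw [key]
  positivity

set_option maxHeartbeats 4000000 in
set_option maxRecDepth 20000 in
/-- Certificate for R1 at hub `h₂`: `bA·cA·(block)` equals a polynomial with non-negative
integer coefficients in the arm weights, `q` and the slacks, hence it is `≥ 0`. [this work] -/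
theorem R11_cert (bA bB bC bD bE bM cA cB cC cD cE cM q : ℝ)
    (hbA : 0 ≤ bA) (hbB : 0 ≤ bB) (hbC : 0 ≤ bC) (hbD : 0 ≤ bD) (hcA : 0 ≤ cA) (hcB : 0 ≤ cB)
    (hcC : 0 ≤ cC) (hcD : 0 ≤ cD) (hq : 0 ≤ q)
    (φb σb φc σc : ℝ) (eφb : bA * bE - bB * (bC + bD) = φb) (eσb : bB * bD - bA * bM = σb)
    (eφc : cA * cE - cB * (cC + cD) = φc) (eσc : cB * cD - cA * cM = σc)
    (hφb : 0 ≤ φb) (hσb : 0 ≤ σb) (hφc : 0 ≤ φc) (hσc : 0 ≤ σc)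
    (Lb Mb Lc Mc Z : ℝ) (eLb : Lb = bA + bB) (eMb : Mb = bC + bD + bE) (eLc : Lc = cA + cB)
    (eMc : Mc = cC + cD + cE) (eZ : Z = q * Lb * Lc + Lb * Mc + Mb * Lc + Mb * Mc)
    (T1 B1 C1 H1 : ℝ) (eT1 : T1 = q * bA * cA + bA * (cC + cD) + (bC + bD) * cA + bD * cD)
    (eB1 : B1 = q * bA * Lc + bA * Mc + (bC + bD) * Lc + bD * Mc)
    (eC1 : C1 = q * cA * Lb + cA * Mb + (cC + cD) * Lb + cD * Mb)
    (eH1 : H1 = Z - (Mb - bD - bM) * (Mc - cD - cM)) :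
    0 ≤ bA * cA * (B1 * C1 - T1 * H1) := by
  have key : bA * cA * (B1 * C1 - T1 * H1) =
        bA^2*bC*cA*q*σc + bA^2*bC*cC*σc + bA^2*bC*cD*σc + bA^2*bC*cD*φc + bA*bB*bC*cA*q*σc
        + bA*bB*bC*cC*σc + bA*bB*bC*cD*σc + bA*bB*bC*cD*φc + bA*bC^2*cA*σc + bA*bC*bD*cA*cC*cD
        + bA*bC*bD*cA*σc + bA*bC*bD*cB*cC*cD + bA*bC*bD*cD*σc + bA*bC*bD*cD*φc + bA*cA^2*cC*q*σb
        + bA*cA*cB*cC*q*σb + bA*cA*cC^2*σb + bA*cA*cC*cD*σb + bA*cA*q*σb*σc + bA*cA*q*σb*φc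
        + bA*cA*q*σc*φb + bA*cA*φb*φc + bA*cB*cC^2*σb + bA*cB*cC*cD*σb + bA*cC*σb*σc + bA*cC*σb*φc
        + bA*cC*σc*φb + bA*cD*σb*σc + bA*cD*σb*φc + bA*cD*σc*φb + bA*cD*φb*φc + bB*bC^2*cA*σc
        + bB*bC*bD*cA*cC*cD + bB*bC*bD*cA*σc + bB*bC*bD*cB*cC*cD + bB*bC*bD*cD*σc + bB*bC*bD*cD*φc
        + bC*cA^2*cC*σb + bC*cA*cB*cC*σb + bC*cA*σb*σc + bC*cA*σb*φc + bC*cA*σc*φb + bD*cA^2*cC*σb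
        + bD*cA^2*cC*φb + bD*cA*cB*cC*σb + bD*cA*cB*cC*φb + bD*cA*cC*cD*σb + bD*cA*cC*cD*φb
        + bD*cA*σb*σc + bD*cA*σb*φc + bD*cA*σc*φb + bD*cA*φb*φc + bD*cB*cC*cD*σb + bD*cB*cC*cD*φb
        + bD*cD*σb*σc + bD*cD*σb*φc + bD*cD*σc*φb + bD*cD*φb*φc := by
    subst eφb eσb eφc eσc eH1 eB1 eC1 eT1 eZ eLb eMb eLc eMc
    ring
  rw [key]
  positivity

set_option maxHeartbeats 4000000 in
set_option maxRecDepth 20000 in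
/-- Certificate for the two-hub cross term: `bA·cA·(block)` equals a polynomial with non-negative
integer coefficients in the arm weights, `q` and the slacks, hence it is `≥ 0`. [this work] -/
theorem CROSS_cert (bA bB bC bD bE bN bM cA cB cC cD cE cN cM q : ℝ)
    (hbA : 0 ≤ bA) (hbB : 0 ≤ bB) (hbC : 0 ≤ bC) (hbD : 0 ≤ bD) (hcA : 0 ≤ cA) (hcB : 0 ≤ cB)
    (hcC : 0 ≤ cC) (hcD : 0 ≤ cD) (hq : 0 ≤ q)
    (φb ρb σb φc ρc σc : ℝ) (eφb : bA * bE - bB * (bC + bD) = φb) (eρb : bB * bC - bA * bN = ρb)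
    (eσb : bB * bD - bA * bM = σb) (eφc : cA * cE - cB * (cC + cD) = φc) (eρc : cB * cC - cA * cN = ρc)
    (eσc : cB * cD - cA * cM = σc)
    (hφb : 0 ≤ φb) (hρb : 0 ≤ ρb) (hσb : 0 ≤ σb) (hφc : 0 ≤ φc) (hρc : 0 ≤ ρc) (hσc : 0 ≤ σc)
    (Lb Mb Lc Mc Z : ℝ) (eLb : Lb = bA + bB) (eMb : Mb = bC + bD + bE) (eLc : Lc = cA + cB)
    (eMc : Mc = cC + cD + cE) (eZ : Z = q * Lb * Lc + Lb * Mc + Mb * Lc + Mb * Mc)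
    (T0 B0 C0 H0 : ℝ) (eT0 : T0 = q * bA * cA + bA * (cC + cD) + (bC + bD) * cA + bC * cC)
    (eB0 : B0 = q * bA * Lc + bA * Mc + (bC + bD) * Lc + bC * Mc)
    (eC0 : C0 = q * cA * Lb + cA * Mb + (cC + cD) * Lb + cC * Mb)
    (eH0 : H0 = Z - (Mb - bC - bN) * (Mc - cC - cN))
    (T1 B1 C1 H1 : ℝ) (eT1 : T1 = q * bA * cA + bA * (cC + cD) + (bC + bD) * cA + bD * cD)
    (eB1 : B1 = q * bA * Lc + bA * Mc + (bC + bD) * Lc + bD * Mc)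
    (eC1 : C1 = q * cA * Lb + cA * Mb + (cC + cD) * Lb + cD * Mb)
    (eH1 : H1 = Z - (Mb - bD - bM) * (Mc - cD - cM)) :
    0 ≤ bA * cA * (B0 * C1 + B1 * C0 - T0 * H1 - T1 * H0) := by
  have key : bA * cA * (B0 * C1 + B1 * C0 - T0 * H1 - T1 * H0) =
        bA^2*bC*cA*q*σc + bA^2*bC*cC*σc + bA^2*bC*cD*σc + bA^2*bC*cD*φc + bA^2*bD*cA*q*ρc
        + bA^2*bD*cC*ρc + bA^2*bD*cC*φc + bA^2*bD*cD*ρc + bA*bB*bC*cA*q*σc + bA*bB*bC*cC*σc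
        + bA*bB*bC*cD*σc + bA*bB*bC*cD*φc + bA*bB*bD*cA*q*ρc + bA*bB*bD*cC*ρc + bA*bB*bD*cC*φc
        + bA*bB*bD*cD*ρc + bA*bC^2*cA*cD^2 + bA*bC^2*cA*σc + bA*bC^2*cB*cD^2 + bA*bC^2*cC*σc
        + bA*bC^2*cD*φc + bA*bC*bD*cA*ρc + bA*bC*bD*cA*σc + bA*bD^2*cA*cC^2 + bA*bD^2*cA*ρc
        + bA*bD^2*cB*cC^2 + bA*bD^2*cC*φc + bA*bD^2*cD*ρc + bA*cA^2*cC*q*σb + bA*cA^2*cD*q*ρb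
        + bA*cA*cB*cC*q*σb + bA*cA*cB*cD*q*ρb + bA*cA*cC^2*σb + bA*cA*cC*cD*ρb + bA*cA*cC*cD*σb
        + bA*cA*cD^2*ρb + bA*cA*q*ρb*ρc + bA*cA*q*ρb*φc + bA*cA*q*ρc*φb + bA*cA*q*σb*σc
        + bA*cA*q*σb*φc + bA*cA*q*σc*φb + 2*bA*cA*φb*φc + bA*cB*cC^2*σb + bA*cB*cC*cD*ρb
        + bA*cB*cC*cD*σb + bA*cB*cD^2*ρb + bA*cC*ρb*ρc + bA*cC*ρb*φc + bA*cC*ρc*φb + bA*cC*σb*σc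
        + bA*cC*σb*φc + bA*cC*σc*φb + bA*cC*φb*φc + bA*cD*ρb*ρc + bA*cD*ρb*φc + bA*cD*ρc*φb
        + bA*cD*σb*σc + bA*cD*σb*φc + bA*cD*σc*φb + bA*cD*φb*φc + bB*bC^2*cA*cD^2 + bB*bC^2*cA*σc
        + bB*bC^2*cB*cD^2 + bB*bC^2*cC*σc + bB*bC^2*cD*φc + bB*bC*bD*cA*ρc + bB*bC*bD*cA*σc
        + bB*bD^2*cA*cC^2 + bB*bD^2*cA*ρc + bB*bD^2*cB*cC^2 + bB*bD^2*cC*φc + bB*bD^2*cD*ρc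
        + bC*cA^2*cC*σb + bC*cA^2*cD*ρb + bC*cA^2*cD*φb + bC*cA*cB*cC*σb + bC*cA*cB*cD*ρb
        + bC*cA*cB*cD*φb + bC*cA*cC^2*σb + bC*cA*cD^2*φb + bC*cA*ρb*ρc + bC*cA*ρb*φc + bC*cA*ρc*φb
        + bC*cA*σb*σc + bC*cA*σb*φc + bC*cA*σc*φb + bC*cA*φb*φc + bC*cB*cC^2*σb + bC*cB*cD^2*φb
        + bC*cC*σb*σc + bC*cC*σb*φc + bC*cC*σc*φb + bC*cD*φb*φc + bD*cA^2*cC*σb + bD*cA^2*cC*φb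
        + bD*cA^2*cD*ρb + bD*cA*cB*cC*σb + bD*cA*cB*cC*φb + bD*cA*cB*cD*ρb + bD*cA*cC^2*φb
        + bD*cA*cD^2*ρb + bD*cA*ρb*ρc + bD*cA*ρb*φc + bD*cA*ρc*φb + bD*cA*σb*σc + bD*cA*σb*φc
        + bD*cA*σc*φb + bD*cA*φb*φc + bD*cB*cC^2*φb + bD*cB*cD^2*ρb + bD*cC*φb*φc + bD*cD*ρb*ρc
        + bD*cD*ρb*φc + bD*cD*ρc*φb := by
    subst eφb eρb eσb eφc eρc eσc eH0 eB0 eC0 eT0 eH1 eB1 eC1 eT1 eZ eLb eMb eLc eMc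
    ring
  rw [key]
  positivity

set_option maxHeartbeats 4000000 in
set_option maxRecDepth 20000 in
/-- Certificate for the wired/free cross term at hub `h₁`: `bA·cA·(block)` equals a polynomial with
non-negative
integer coefficients in the arm weights, `q` and the slacks, hence it is `≥ 0`. [this work] -/
theorem W0_cert (bA bB bC bD bE bN cA cB cC cD cE cN q : ℝ)
    (hbA : 0 ≤ bA) (hbB : 0 ≤ bB) (hbC : 0 ≤ bC) (hbD : 0 ≤ bD) (hcA : 0 ≤ cA) (hcB : 0 ≤ cB)
    (hcC : 0 ≤ cC) (hcD : 0 ≤ cD) (hq : 0 ≤ q)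
    (φb ρb φc ρc : ℝ) (eφb : bA * bE - bB * (bC + bD) = φb) (eρb : bB * bC - bA * bN = ρb)
    (eφc : cA * cE - cB * (cC + cD) = φc) (eρc : cB * cC - cA * cN = ρc)
    (hφb : 0 ≤ φb) (hρb : 0 ≤ ρb) (hφc : 0 ≤ φc) (hρc : 0 ≤ ρc)
    (Lb Mb Lc Mc Z : ℝ) (eLb : Lb = bA + bB) (eMb : Mb = bC + bD + bE) (eLc : Lc = cA + cB)
    (eMc : Mc = cC + cD + cE) (eZ : Z = q * Lb * Lc + Lb * Mc + Mb * Lc + Mb * Mc)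
    (T0 B0 C0 H0 : ℝ) (eT0 : T0 = q * bA * cA + bA * (cC + cD) + (bC + bD) * cA + bC * cC)
    (eB0 : B0 = q * bA * Lc + bA * Mc + (bC + bD) * Lc + bC * Mc)
    (eC0 : C0 = q * cA * Lb + cA * Mb + (cC + cD) * Lb + cC * Mb)
    (eH0 : H0 = Z - (Mb - bC - bN) * (Mc - cC - cN))
    (xb xb' yc yc' : ℝ) (exb : xb = q * bA + bC + bD) (exb' : xb' = q * bB + bE)
    (eyc : yc = q * cA + cC + cD) (eyc' : yc' = q * cB + cE) :
    0 ≤ bA * cA * (yc * (xb + xb') * B0 + xb * (yc + yc') * C0 - (xb + xb') * (yc + yc') * T0 - xb * yc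
    * H0) := by
  have key : bA * cA * (yc * (xb + xb') * B0 + xb * (yc + yc') * C0 - (xb + xb') * (yc + yc') * T0 - xb * yc * H0) =
        bA^2*bD*cA*q^2*ρc + bA^2*bD*cC*q*ρc + bA^2*bD*cC*q*φc + bA^2*bD*cD*q*ρc
        + bA*bB*bD*cA*q^2*ρc + bA*bB*bD*cC*q*ρc + bA*bB*bD*cC*q*φc + bA*bB*bD*cD*q*ρc
        + bA*bC*bD*cA*q*ρc + bA*bC*bD*cC*ρc + bA*bC*bD*cC*φc + bA*bC*bD*cD*ρc + bA*bD^2*cA*q*ρc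
        + bA*bD^2*cC*ρc + bA*bD^2*cC*φc + bA*bD^2*cD*ρc + bA*cA^2*cD*q^2*ρb + bA*cA*cB*cD*q^2*ρb
        + bA*cA*cC*cD*q*ρb + bA*cA*cD^2*q*ρb + bA*cA*q^2*ρb*ρc + bA*cA*q^2*ρb*φc + bA*cA*q^2*ρc*φb
        + bA*cA*q*φb*φc + bA*cB*cC*cD*q*ρb + bA*cB*cD^2*q*ρb + bA*cC*q*ρb*ρc + bA*cC*q*ρb*φc
        + bA*cC*q*ρc*φb + bA*cC*q*φb*φc + bA*cD*q*ρb*ρc + bA*cD*q*ρb*φc + bA*cD*q*ρc*φb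
        + bB*bC*bD*cA*q*ρc + bB*bC*bD*cC*ρc + bB*bC*bD*cC*φc + bB*bC*bD*cD*ρc + bB*bD^2*cA*q*ρc
        + bB*bD^2*cC*ρc + bB*bD^2*cC*φc + bB*bD^2*cD*ρc + bC*cA^2*cD*q*ρb + bC*cA^2*cD*q*φb
        + bC*cA*cB*cD*q*ρb + bC*cA*cB*cD*q*φb + bC*cA*cC*cD*ρb + bC*cA*cC*cD*φb + bC*cA*cD^2*ρb
        + bC*cA*cD^2*φb + bC*cA*q*ρb*ρc + bC*cA*q*ρb*φc + bC*cA*q*ρc*φb + bC*cA*q*φb*φc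
        + bC*cB*cC*cD*ρb + bC*cB*cC*cD*φb + bC*cB*cD^2*ρb + bC*cB*cD^2*φb + bC*cC*ρb*ρc
        + bC*cC*ρb*φc + bC*cC*ρc*φb + bC*cC*φb*φc + bC*cD*ρb*ρc + bC*cD*ρb*φc + bC*cD*ρc*φb
        + bC*cD*φb*φc + bD*cA^2*cD*q*ρb + bD*cA*cB*cD*q*ρb + bD*cA*cC*cD*ρb + bD*cA*cD^2*ρb
        + bD*cA*q*ρb*ρc + bD*cA*q*ρb*φc + bD*cA*q*ρc*φb + bD*cB*cC*cD*ρb + bD*cB*cD^2*ρb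
        + bD*cC*ρb*ρc + bD*cC*ρb*φc + bD*cC*ρc*φb + bD*cC*φb*φc + bD*cD*ρb*ρc + bD*cD*ρb*φc
        + bD*cD*ρc*φb := by
    subst eφb eρb eφc eρc eH0 eB0 eC0 eT0 eZ eLb eMb eLc eMc exb exb' eyc eyc'
    ring
  rw [key]
  positivity

set_option maxHeartbeats 4000000 in
set_option maxRecDepth 20000 in
/-- Certificate for the wired/free cross term at hub `h₂`: `bA·cA·(block)` equals a polynomial with
non-negative
integer coefficients in the arm weights, `q` and the slacks, hence it is `≥ 0`. [this work] -/
theorem W1_cert (bA bB bC bD bE bM cA cB cC cD cE cM q : ℝ)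
    (hbA : 0 ≤ bA) (hbB : 0 ≤ bB) (hbC : 0 ≤ bC) (hbD : 0 ≤ bD) (hcA : 0 ≤ cA) (hcB : 0 ≤ cB)
    (hcC : 0 ≤ cC) (hcD : 0 ≤ cD) (hq : 0 ≤ q)
    (φb σb φc σc : ℝ) (eφb : bA * bE - bB * (bC + bD) = φb) (eσb : bB * bD - bA * bM = σb)
    (eφc : cA * cE - cB * (cC + cD) = φc) (eσc : cB * cD - cA * cM = σc)
    (hφb : 0 ≤ φb) (hσb : 0 ≤ σb) (hφc : 0 ≤ φc) (hσc : 0 ≤ σc)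
    (Lb Mb Lc Mc Z : ℝ) (eLb : Lb = bA + bB) (eMb : Mb = bC + bD + bE) (eLc : Lc = cA + cB)
    (eMc : Mc = cC + cD + cE) (eZ : Z = q * Lb * Lc + Lb * Mc + Mb * Lc + Mb * Mc)
    (T1 B1 C1 H1 : ℝ) (eT1 : T1 = q * bA * cA + bA * (cC + cD) + (bC + bD) * cA + bD * cD)
    (eB1 : B1 = q * bA * Lc + bA * Mc + (bC + bD) * Lc + bD * Mc)
    (eC1 : C1 = q * cA * Lb + cA * Mb + (cC + cD) * Lb + cD * Mb)
    (eH1 : H1 = Z - (Mb - bD - bM) * (Mc - cD - cM))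
    (xb xb' yc yc' : ℝ) (exb : xb = q * bA + bC + bD) (exb' : xb' = q * bB + bE)
    (eyc : yc = q * cA + cC + cD) (eyc' : yc' = q * cB + cE) :
    0 ≤ bA * cA * (yc * (xb + xb') * B1 + xb * (yc + yc') * C1 - (xb + xb') * (yc + yc') * T1 - xb * yc
    * H1) := by
  have key : bA * cA * (yc * (xb + xb') * B1 + xb * (yc + yc') * C1 - (xb + xb') * (yc + yc') * T1 - xb * yc * H1) =
        bA^2*bC*cA*q^2*σc + bA^2*bC*cC*q*σc + bA^2*bC*cD*q*σc + bA^2*bC*cD*q*φc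
        + bA*bB*bC*cA*q^2*σc + bA*bB*bC*cC*q*σc + bA*bB*bC*cD*q*σc + bA*bB*bC*cD*q*φc
        + bA*bC^2*cA*q*σc + bA*bC^2*cC*σc + bA*bC^2*cD*σc + bA*bC^2*cD*φc + bA*bC*bD*cA*q*σc
        + bA*bC*bD*cC*σc + bA*bC*bD*cD*σc + bA*bC*bD*cD*φc + bA*cA^2*cC*q^2*σb
        + bA*cA*cB*cC*q^2*σb + bA*cA*cC^2*q*σb + bA*cA*cC*cD*q*σb + bA*cA*q^2*σb*σc
        + bA*cA*q^2*σb*φc + bA*cA*q^2*σc*φb + bA*cA*q*φb*φc + bA*cB*cC^2*q*σb + bA*cB*cC*cD*q*σb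
        + bA*cC*q*σb*σc + bA*cC*q*σb*φc + bA*cC*q*σc*φb + bA*cD*q*σb*σc + bA*cD*q*σb*φc
        + bA*cD*q*σc*φb + bA*cD*q*φb*φc + bB*bC^2*cA*q*σc + bB*bC^2*cC*σc + bB*bC^2*cD*σc
        + bB*bC^2*cD*φc + bB*bC*bD*cA*q*σc + bB*bC*bD*cC*σc + bB*bC*bD*cD*σc + bB*bC*bD*cD*φc
        + bC*cA^2*cC*q*σb + bC*cA*cB*cC*q*σb + bC*cA*cC^2*σb + bC*cA*cC*cD*σb + bC*cA*q*σb*σc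
        + bC*cA*q*σb*φc + bC*cA*q*σc*φb + bC*cB*cC^2*σb + bC*cB*cC*cD*σb + bC*cC*σb*σc
        + bC*cC*σb*φc + bC*cC*σc*φb + bC*cD*σb*σc + bC*cD*σb*φc + bC*cD*σc*φb + bC*cD*φb*φc
        + bD*cA^2*cC*q*σb + bD*cA^2*cC*q*φb + bD*cA*cB*cC*q*σb + bD*cA*cB*cC*q*φb + bD*cA*cC^2*σb
        + bD*cA*cC^2*φb + bD*cA*cC*cD*σb + bD*cA*cC*cD*φb + bD*cA*q*σb*σc + bD*cA*q*σb*φc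
        + bD*cA*q*σc*φb + bD*cA*q*φb*φc + bD*cB*cC^2*σb + bD*cB*cC^2*φb + bD*cB*cC*cD*σb
        + bD*cB*cC*cD*φb + bD*cC*σb*σc + bD*cC*σb*φc + bD*cC*σc*φb + bD*cC*φb*φc + bD*cD*σb*σc
        + bD*cD*σb*φc + bD*cD*σc*φb + bD*cD*φb*φc := by
    subst eφb eσb eφc eσc eH1 eB1 eC1 eT1 eZ eLb eMb eLc eMc exb exb' eyc eyc'
    ring
  rw [key]
  positivity

set_option maxHeartbeats 4000000 in
set_option maxRecDepth 20000 in
/-- **The Θ-slack is non-negative** (times `bA·cA`): if both terminal arms satisfy FKG (`φ ≥ 0`) and the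
refined row R1 at each hub (`ρ, σ ≥ 0`), then `bA·cA·(u_b·u_c − t·s_a) ≥ 0` on `Θ(A_a, A_b, A_c)` for
every
`q ≥ 0` and all non-negative apex-arm weights `aA, aC, aD`. [this work] -/
theorem theta_slack_nonneg (aA aC aD : ℝ) (haA : 0 ≤ aA) (haC : 0 ≤ aC) (haD : 0 ≤ aD)
    (bA bB bC bD bE bN bM cA cB cC cD cE cN cM q : ℝ)
    (hbA : 0 ≤ bA) (hbB : 0 ≤ bB) (hbC : 0 ≤ bC) (hbD : 0 ≤ bD) (hcA : 0 ≤ cA) (hcB : 0 ≤ cB)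
    (hcC : 0 ≤ cC) (hcD : 0 ≤ cD) (hq : 0 ≤ q)
    (φb ρb σb φc ρc σc : ℝ) (eφb : bA * bE - bB * (bC + bD) = φb) (eρb : bB * bC - bA * bN = ρb)
    (eσb : bB * bD - bA * bM = σb)
    (eφc : cA * cE - cB * (cC + cD) = φc) (eρc : cB * cC - cA * cN = ρc) (eσc : cB * cD - cA * cM = σc)
    (hφb : 0 ≤ φb) (hρb : 0 ≤ ρb) (hσb : 0 ≤ σb) (hφc : 0 ≤ φc) (hρc : 0 ≤ ρc) (hσc : 0 ≤ σc)
    (Lb Mb Lc Mc Z : ℝ) (eLb : Lb = bA + bB) (eMb : Mb = bC + bD + bE) (eLc : Lc = cA + cB)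
    (eMc : Mc = cC + cD + cE) (eZ : Z = q * Lb * Lc + Lb * Mc + Mb * Lc + Mb * Mc)
    (T0 B0 C0 H0 : ℝ) (eT0 : T0 = q * bA * cA + bA * (cC + cD) + (bC + bD) * cA + bC * cC)
    (eB0 : B0 = q * bA * Lc + bA * Mc + (bC + bD) * Lc + bC * Mc)
    (eC0 : C0 = q * cA * Lb + cA * Mb + (cC + cD) * Lb + cC * Mb)
    (eH0 : H0 = Z - (Mb - bC - bN) * (Mc - cC - cN))
    (T1 B1 C1 H1 : ℝ) (eT1 : T1 = q * bA * cA + bA * (cC + cD) + (bC + bD) * cA + bD * cD)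
    (eB1 : B1 = q * bA * Lc + bA * Mc + (bC + bD) * Lc + bD * Mc)
    (eC1 : C1 = q * cA * Lb + cA * Mb + (cC + cD) * Lb + cD * Mb)
    (eH1 : H1 = Z - (Mb - bD - bM) * (Mc - cD - cM))
    (xb xb' yc yc' : ℝ) (exb : xb = q * bA + bC + bD) (exb' : xb' = q * bB + bE)
    (eyc : yc = q * cA + cC + cD) (eyc' : yc' = q * cB + cE)
    (T S Ub Uc : ℝ) (eT : T = aA * xb * yc + aC * T0 + aD * T1)
    (eUc : Uc = aA * xb * yc' + aC * (B0 - T0) + aD * (B1 - T1))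
    (eUb : Ub = aA * xb' * yc + aC * (C0 - T0) + aD * (C1 - T1))
    (eS : S = aA * xb' * yc' + aC * (H0 - B0 - C0 + T0) + aD * (H1 - B1 - C1 + T1)) :
    0 ≤ bA * cA * (Ub * Uc - T * S) := by
  have h0 := R10_cert bA bB bC bD bE bN cA cB cC cD cE cN q hbA hbB hbC hbD hcA hcB hcC hcD hq φb ρb
      φc ρc eφb eρb eφc eρc hφb hρb hφc hρc Lb Mb Lc Mc Z eLb eMb eLc eMc eZ T0 B0 C0 H0 eT0 eB0 eC0
      eH0
  have h1 := R11_cert bA bB bC bD bE bM cA cB cC cD cE cM q hbA hbB hbC hbD hcA hcB hcC hcD hq φb σb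
      φc σc eφb eσb eφc eσc hφb hσb hφc hσc Lb Mb Lc Mc Z eLb eMb eLc eMc eZ T1 B1 C1 H1 eT1 eB1 eC1
      eH1
  have h2 := CROSS_cert bA bB bC bD bE bN bM cA cB cC cD cE cN cM q hbA hbB hbC hbD hcA hcB hcC hcD
      hq φb ρb σb φc ρc σc eφb eρb eσb eφc eρc eσc hφb hρb hσb hφc hρc hσc Lb Mb Lc Mc Z eLb eMb eLc
      eMc eZ T0 B0 C0 H0 eT0 eB0 eC0 eH0 T1 B1 C1 H1 eT1 eB1 eC1 eH1
  have h3 := W0_cert bA bB bC bD bE bN cA cB cC cD cE cN q hbA hbB hbC hbD hcA hcB hcC hcD hq φb ρb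
      φc ρc eφb eρb eφc eρc hφb hρb hφc hρc Lb Mb Lc Mc Z eLb eMb eLc eMc eZ T0 B0 C0 H0 eT0 eB0 eC0
      eH0 xb xb' yc yc' exb exb' eyc eyc'
  have h4 := W1_cert bA bB bC bD bE bM cA cB cC cD cE cM q hbA hbB hbC hbD hcA hcB hcC hcD hq φb σb
      φc σc eφb eσb eφc eσc hφb hσb hφc hσc Lb Mb Lc Mc Z eLb eMb eLc eMc eZ T1 B1 C1 H1 eT1 eB1 eC1
      eH1 xb xb' yc yc' exb exb' eyc eyc'
  rw [theta_identity aA aC aD bA bB bC bD bE bN bM cA cB cC cD cE cN cM q Lb Mb Lc Mc Z eLb eMb eLc eMc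
      eZ T0 B0 C0 H0 eT0 eB0 eC0 eH0 T1 B1 C1 H1 eT1 eB1 eC1 eH1 xb xb' yc yc' exb exb' eyc eyc' T S Ub Uc
      eT eUc eUb eS]
  have t0 := mul_nonneg (pow_nonneg haC 2) h0
  have t1 := mul_nonneg (pow_nonneg haD 2) h1
  have t2 := mul_nonneg (mul_nonneg haC haD) h2
  have t3 := mul_nonneg (mul_nonneg haA haC) h3
  have t4 := mul_nonneg (mul_nonneg haA haD) h4
  nlinarith [t0, t1, t2, t3, t4]

end ThetaBlocks

end Summit.CriticalPhenomena.PercolationContinuityZ3.Theorems
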